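import Summits.Schanuel.Schanuel.Theorems.ZilberEacMovingLineDefs
import Summits.Schanuel.Schanuel.Theorems.ZilberEacGrowthDensityPuncture
import Summits.Schanuel.Schanuel.Theorems.ZilberEacComplexOscillatoryBase
import HarnessLib

/-!
# Moving targets over graph bases in the puncture regime: every such surface answers MM's question YES

Zilber's Exponential-Algebraic Closedness, case ladder (host summit Schanuel, cell `pub-schanuel`,
seat 2, gen 8).  Seat 2 gen 5 (`ZilberEacGrowthDensityPuncture.unprojectedDense_fibredGraph_one`)
proved Zariski density of the exponential points of the puncture-type surfaces
`{x₁ = g(x₀), y₀ = a x₀ + b + y₁ F(y₁, x₀)}` with AFFINE additive part `a x₀ + b`.  Here the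
additive part is an ARBITRARY polynomial `A(x₀)` (with non-vanishing leading form at the lattice
direction — automatic in one variable for `A ≠ 0`): the surfaces
`W = polyFibredGraph g A F = {x₁ = g(x₀), y₀ = A(x₀) + y₁ F(y₁, x₀)} ⊆ ℂ² × ℂ²`
(seat 1's certified family with `s = 1`; `F ∈ ℂ[u, x₀]` may depend on `x₀`).

* `unprojectedDense_polyFibredGraph_one`: `deg g ≥ 1`, `Re g_D(2πi q) < 0`, `(A)_d(2πi q) ≠ 0`, any
  `F` ⇒ the exponential points of `W` are ZARISKI DENSE.  Existence is the oscillatory-base theorem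
  (`exists_expPoint_of_re_leadingForm_neg`); density is THEOREM G (`unprojectedDense_of_growth`) on
  the coordinate `x₁ = g(x₀)`: `Re x₁ ≤ -(c₀/2) m^D` against `‖x₁‖ = O(m^D)`.
* Univariate corollaries (`movingGraphSurface p A F := polyFibredGraph (p) (A) (F)` with
  `p, A ∈ ℂ[x]`): `unprojectedDense_movingGraph` under seat 1's leading-coefficient criterion
  `Re(lc(p) (σ i)^{deg p}) < 0` (`σ = ±1`), `A ≠ 0`, any `F ∈ ℂ[u, x₀]`; in particular lines of
  NON-REAL slope with `x₀`-DEPENDENT fibre polynomial (`unprojectedDense_movingLineX_of_im_ne_zero`),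
  and graph bases of degree `≥ 2` — certified members of Mantova–Masser's case, multiplicatively free
  (`mmCase_movingGraph_of_two_le`, `unprojectedDensityQuestion_instance_movingGraph`).
* Example: `e^{z} = z + e^{2 z²} + z e^{z²}` (`{x₁ = x₀², y₀ = x₀ + y₁ (y₁ + x₀)}`).

HONEST FRAMING: explicit families of instances of an OPEN question (Mantova–Masser 2024 §1); the
oscillatory regime `Re g_D(2πi q) = 0 ∀ q` with moving fibres, real-slope lines with `x₀`-dependent
`F`, and `EC(3,2)` remain OPEN; NOT Schanuel's conjecture; EAC ⇏ SC.
-/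

noncomputable section

open Complex MvPolynomial Filter Topology
open Literature.NumberTheory.Transcendental Literature.ModelTheory.Zilber

set_option linter.dupNamespace false

namespace Summit.Schanuel.Schanuel.Theorems

/-! ## Part 1. The general puncture-regime density theorem for `polyFibredGraph` (`s = 1`) -/

section General

/-- **Every puncture-type moving-target surface answers Mantova–Masser's density question YES.**
For `g ∈ ℂ[x₀]` of degree `D ≥ 1` with `Re g_D(2πiq) < 0`, `A ∈ ℂ[x₀]` with `A_d(2πi q) ≠ 0` and ANY
`F ∈ ℂ[u, x₀]`, the exponential points of `polyFibredGraph g A F = {x₁ = g(x₀), y₀ = A(x₀) + y₁ F(y₁, x₀)}`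
are Zariski dense.  (Seat 2 gen 5's `unprojectedDense_fibredGraph_one` is the case of affine `A`.)
(new) [cite: MantovaMasser2023, §1 Further remarks] -/
theorem unprojectedDense_polyFibredGraph_one (g : MvPolynomial (Fin 1) ℂ) (hD : 0 < g.totalDegree)
    (q : Fin 1 → ℤ)
    (hq : (eval (fun j => 2 * Real.pi * I * (q j : ℂ)) (homogeneousComponent g.totalDegree g)).re < 0)
    (A : Fin 1 → MvPolynomial (Fin 1) ℂ)
    (hA : ∀ j, eval (fun i => 2 * Real.pi * I * (q i : ℂ))
      (homogeneousComponent (A j).totalDegree (A j)) ≠ 0)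
    (F : Fin 1 → MvPolynomial (Fin (1 + 1)) ℂ) :
    UnprojectedDense (polyFibredGraph g A F) := by
  classical
  obtain ⟨m₀, hsol⟩ := eventually_atTop.1 (exists_expPoint_of_re_leadingForm_neg g hD q hq A hA F)
  -- the solutions, as a sequence indexed by all `m` (constant below `m₀`)
  have hsol' : ∀ m : ℕ, ∃ x : Fin 1 → ℂ,
      ‖x - fun i => ((max m m₀ : ℕ) : ℂ) * (2 * Real.pi * I * (q i : ℂ)) +
          log (eval (fun k => ((max m m₀ : ℕ) : ℂ) * (2 * Real.pi * I * (q k : ℂ))) (A i))‖ ≤ 1 / 2 ∧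
      ∀ j, exp (x j) = eval x (A j) +
        exp (eval x g) * eval (Fin.cons (exp (eval x g)) x) (F j) :=
    fun m => hsol (max m m₀) (le_max_right _ _)
  choose xs hxs using hsol'
  -- the exponential points
  set p : ℕ → Fin (1 + 1) ⊕ Fin (1 + 1) → ℂ := fun m =>
    Sum.elim (Fin.snoc (xs m) (eval (xs m) g))
      (Fin.snoc (fun j => exp (xs m j)) (exp (eval (xs m) g))) with hp
  have hpS : ∀ m, p m ∈ polyFibredGraph g A F := by
    intro m
    rw [mem_polyFibredGraph_iff]
    have h1 : (fun j : Fin 1 => p m (Sum.inl (Fin.castSucc j))) = xs m := by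
      funext j; simp only [hp, Sum.elim_inl, Fin.snoc_castSucc]
    refine ⟨?_, fun j => ?_⟩
    · rw [h1]; simp only [hp, Sum.elim_inl, Fin.snoc_last]
    · rw [h1]
      simp only [hp, Sum.elim_inr, Fin.snoc_castSucc, Fin.snoc_last]
      exact (hxs m).2 j
  have hpΓ : ∀ m, p m ∈ expGraph ℂ (1 + 1) := by
    intro m
    rw [mem_expGraph_iff]
    intro i
    rw [Literature.ModelTheory.ExponentialFields.ExponentialRing.complex_exp_eq]
    rcases Fin.eq_castSucc_or_eq_last i with ⟨j, rfl⟩ | rfl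
    · simp only [hp, Sum.elim_inr, Sum.elim_inl, Fin.snoc_castSucc]
    · simp only [hp, Sum.elim_inr, Sum.elim_inl, Fin.snoc_last]
  have hdim : zariskiDim ℂ (polyFibredGraph g A F) ≤ (2 : ℕ) := (zariskiDim_polyFibredGraph g A F).le
  refine unprojectedDense_of_growth (isIrreducibleClosed_polyFibredGraph g A F) hdim (Fin.last 1)
    hpS hpΓ ?_
  -- growth of `x₁ = g(x₀)` along the solutions
  have hcoord : ∀ m, p m (Sum.inl (Fin.last 1)) = eval (xs m) g := fun m => by
    simp only [hp, Sum.elim_inl, Fin.snoc_last]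
  simp only [hcoord]
  -- constants
  set D := g.totalDegree with hDdef
  set v : Fin 1 → ℂ := fun j => 2 * Real.pi * I * (q j : ℂ) with hv
  set gD := eval v (homogeneousComponent D g) with hgD
  set c₀ : ℝ := -gD.re with hc₀
  have hc₀pos : 0 < c₀ := by rw [hc₀]; linarith
  obtain ⟨ρ, hρ, t₀, ht₀, hnear⟩ := ExpDominant.eval_smul_near_top g v (half_pos hc₀pos)
  -- `‖log-vector‖ + 1 ≤ (ρ/2) m` eventually
  have hαev := eventually_norm_log_latticeValue_le A v hA (half_pos hρ)
  -- the asymptotic estimate: `Re g(x_m) ≤ -(c₀/2) M^D` and `‖g(x_m)‖ ≤ C₁ M^D`, `M = max m m₀`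
  have hest : ∀ᶠ m : ℕ in atTop,
      (eval (xs m) g).re ≤ -(c₀ / 2) * ((max m m₀ : ℕ) : ℝ) ^ D ∧
        ‖eval (xs m) g‖ ≤ (‖gD‖ + c₀ / 2) * ((max m m₀ : ℕ) : ℝ) ^ D := by
    have hev1 : ∀ᶠ m : ℕ in atTop, m₀ ≤ m := eventually_ge_atTop m₀
    have hev2 : ∀ᶠ m : ℕ in atTop, t₀ ≤ (m : ℝ) := tendsto_natCast_atTop_atTop.eventually_ge_atTop t₀
    have hev3 : ∀ᶠ m : ℕ in atTop, 1 / ρ ≤ (m : ℝ) :=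
      tendsto_natCast_atTop_atTop.eventually_ge_atTop (1 / ρ)
    filter_upwards [hev1, hev2, hev3, hαev] with m hm₀ hmt hmρ hα
    have hmax : max m m₀ = m := max_eq_left hm₀
    have hspec := (hxs m).1
    rw [hmax] at hspec
    rw [hmax]
    have hm0 : (0 : ℝ) < m := lt_of_lt_of_le (by positivity) hmρ
    have hmne : (m : ℂ) ≠ 0 := by exact_mod_cast hm0.ne'
    -- write `x_m = m (v + ζ)` with `‖ζ‖ ≤ ρ`
    set ζ : Fin 1 → ℂ := (m : ℂ)⁻¹ • xs m - v with hζ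
    have hxζ : xs m = (m : ℂ) • (v + ζ) := by
      rw [hζ, add_sub_cancel, smul_smul, mul_inv_cancel₀ hmne, one_smul]
    have hζnorm : ‖ζ‖ ≤ ρ := by
      have h1 : ζ = (m : ℂ)⁻¹ • (xs m - (m : ℂ) • v) := by
        rw [hζ, smul_sub, smul_smul, inv_mul_cancel₀ hmne, one_smul]
      -- `‖x_m - m v‖ ≤ 1/2 + ‖log-vector‖`
      have h2 : ‖xs m - (m : ℂ) • v‖ ≤ 1 / 2 + ρ / 2 * m := by
        have hsplit : xs m - (m : ℂ) • v =
            (xs m - fun i => (m : ℂ) * (2 * Real.pi * I * (q i : ℂ)) +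
              log (eval (fun k => (m : ℂ) * (2 * Real.pi * I * (q k : ℂ))) (A i))) +
            (fun i : Fin 1 => log (eval (fun k => (m : ℂ) * (2 * Real.pi * I * (q k : ℂ))) (A i))) := by
          funext j
          simp only [hv, Pi.sub_apply, Pi.add_apply, Pi.smul_apply, smul_eq_mul]
          ring
        rw [hsplit]
        refine (norm_add_le _ _).trans (add_le_add hspec ?_)
        have hα' : ‖fun i : Fin 1 => log (eval (fun k => (m : ℂ) * v k) (A i))‖ + 1 ≤ ρ / 2 * m := hα
        simp only [hv] at hα'
        linarith [hα']
      rw [h1, norm_smul, norm_inv, Complex.norm_natCast]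
      calc (m : ℝ)⁻¹ * ‖xs m - (m : ℂ) • v‖ ≤ (m : ℝ)⁻¹ * (1 / 2 + ρ / 2 * m) :=
            mul_le_mul_of_nonneg_left h2 (inv_nonneg.2 hm0.le)
        _ = (1 / 2) / m + ρ / 2 := by field_simp
        _ ≤ ρ := by
            have h3 : (1 / 2) / (m : ℝ) ≤ ρ / 2 := by
              rw [div_le_iff₀ hm0]
              have : 1 ≤ ρ * m := by rwa [div_le_iff₀ hρ, mul_comm] at hmρ
              linarith
            linarith
    have hkey := hnear m hmt ζ hζnorm
    rw [Complex.ofReal_natCast, ← hxζ] at hkey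
    have hre : ((m : ℂ) ^ D * gD).re = (m : ℝ) ^ D * gD.re := by
      rw [← Complex.ofReal_natCast, ← Complex.ofReal_pow, Complex.re_ofReal_mul]
    constructor
    · have h1 := (Complex.abs_re_le_norm (eval (xs m) g - (m : ℂ) ^ D * gD)).trans hkey
      rw [Complex.sub_re, hre] at h1
      have h2 := (abs_le.1 h1).2
      rw [hc₀]
      nlinarith
    · calc ‖eval (xs m) g‖ ≤ ‖(m : ℂ) ^ D * gD‖ + ‖eval (xs m) g - (m : ℂ) ^ D * gD‖ :=
            norm_le_insert' _ _
        _ ≤ (m : ℝ) ^ D * ‖gD‖ + c₀ / 2 * (m : ℝ) ^ D := by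
            rw [norm_mul, norm_pow, Complex.norm_natCast]
            linarith [hkey]
        _ = (‖gD‖ + c₀ / 2) * (m : ℝ) ^ D := by ring
  -- conclude: the ratio dominates `(c₀/2) · m / (A₀ + D log m)`
  set A₀ : ℝ := Real.log (2 + (‖gD‖ + c₀ / 2)) with hA₀
  have hApos : 0 < A₀ := Real.log_pos (by linarith [norm_nonneg gD])
  have hlow := (tendsto_div_const_add_mul_log hApos (Nat.cast_nonneg D)).const_mul_atTop
    (half_pos hc₀pos)
  refine tendsto_atTop_mono' atTop ?_ hlow
  filter_upwards [hest, eventually_ge_atTop m₀, eventually_ge_atTop 1] with m hm hm₀ hm1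
  obtain ⟨hre, hnorm⟩ := hm
  rw [max_eq_left hm₀] at hre hnorm
  have hm1' : (1 : ℝ) ≤ m := by exact_mod_cast hm1
  have hmD : (m : ℝ) ≤ (m : ℝ) ^ D := by
    calc (m : ℝ) = (m : ℝ) ^ 1 := (pow_one _).symm
      _ ≤ (m : ℝ) ^ D := pow_le_pow_right₀ hm1' hD
  have hmDpos : 0 < (m : ℝ) ^ D := by positivity
  have hden : Real.log (2 + ‖eval (xs m) g‖) ≤ A₀ + D * Real.log m := by
    have h1 : 2 + ‖eval (xs m) g‖ ≤ (2 + (‖gD‖ + c₀ / 2)) * (m : ℝ) ^ D := by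
      have : (2 : ℝ) ≤ 2 * (m : ℝ) ^ D := by nlinarith
      nlinarith [norm_nonneg gD]
    calc Real.log (2 + ‖eval (xs m) g‖) ≤ Real.log ((2 + (‖gD‖ + c₀ / 2)) * (m : ℝ) ^ D) :=
          Real.log_le_log (by linarith [norm_nonneg (eval (xs m) g)]) h1
      _ = A₀ + D * Real.log m := by
          rw [Real.log_mul (by linarith [norm_nonneg gD]) hmDpos.ne', Real.log_pow]
  have hdenpos : 0 < Real.log (2 + ‖eval (xs m) g‖) :=
    Real.log_pos (by linarith [norm_nonneg (eval (xs m) g)])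
  have hnum : c₀ / 2 * (m : ℝ) ≤ |(eval (xs m) g).re| := by
    rw [abs_of_nonpos (by nlinarith)]
    nlinarith
  calc c₀ / 2 * ((m : ℝ) / (A₀ + D * Real.log m))
      = (c₀ / 2 * m) / (A₀ + D * Real.log m) := by ring
    _ ≤ |(eval (xs m) g).re| / (A₀ + D * Real.log m) :=
        div_le_div_of_nonneg_right hnum (by nlinarith [Real.log_natCast_nonneg m])
    _ ≤ |(eval (xs m) g).re| / Real.log (2 + ‖eval (xs m) g‖) :=
        div_le_div_of_nonneg_left (abs_nonneg _) hdenpos hden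

end General

/-! ## Part 2. Univariate corollaries: `{x₁ = p(x₀), y₀ = A(x₀) + y₁ F(y₁, x₀)}` -/

section Univariate

/-- **The moving-target graph surface** `{x₁ = p(x₀), y₀ = A(x₀) + y₁ F(y₁, x₀)}` with univariate
`p, A ∈ ℂ[x]` and `F ∈ ℂ[u, x₀]` (variable `0` = `y₁`, variable `1` = `x₀`), as seat 1's
`polyFibredGraph`. [cite: MantovaMasser2023, §1 Further remarks] -/
def movingGraphSurface (p A : Polynomial ℂ) (F : MvPolynomial (Fin 2) ℂ) : Set (Fin 2 ⊕ Fin 2 → ℂ) :=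
  polyFibredGraph (p.toMvPolynomial 0) ![A.toMvPolynomial 0] ![F]

variable (p A : Polynomial ℂ) (F : MvPolynomial (Fin 2) ℂ)

/-- Membership in coordinates. [folklore] -/
theorem mem_movingGraphSurface_iff (z : Fin 2 ⊕ Fin 2 → ℂ) :
    z ∈ movingGraphSurface p A F ↔
      z (Sum.inl 1) = p.eval (z (Sum.inl 0)) ∧
        z (Sum.inr 0) = A.eval (z (Sum.inl 0)) + z (Sum.inr 1) * eval ![z (Sum.inr 1), z (Sum.inl 0)] F := by
  have hfun : (Fin.cons (z (Sum.inr (Fin.last 1))) (fun j : Fin 1 => z (Sum.inl (Fin.castSucc j))) :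
      Fin (1 + 1) → ℂ) = ![z (Sum.inr 1), z (Sum.inl 0)] := by
    funext i
    fin_cases i <;> rfl
  rw [movingGraphSurface, mem_polyFibredGraph_iff, Fin.forall_fin_one]
  simp only [Matrix.cons_val_fin_one, MvPolynomial.eval_toMvPolynomial, hfun]
  rfl

/-- Lines are the degree-one case: `movingGraphSurface (linePoly a b) = polyFibredGraph (linBase a b) …`.
[folklore] -/
theorem movingGraphSurface_linePoly (a b : ℂ) :
    movingGraphSurface (linePoly a b) A F = polyFibredGraph (linBase a b) ![A.toMvPolynomial 0] ![F] :=
  rfl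

/-- **Density under the leading-coefficient criterion.**  `deg p ≥ 1`, `Re(lc(p) (σ i)^{deg p}) < 0`
for a sign `σ = ±1`, `A ≠ 0`, ANY `F ∈ ℂ[u, x₀]`: the exponential points of
`{x₁ = p(x₀), y₀ = A(x₀) + y₁ F(y₁, x₀)}` — the solutions of `e^{z} = A(z) + e^{p(z)} F(e^{p(z)}, z)` —
are Zariski dense.  (Lattice direction `q = σ`: `Re p_D(2πiσ) = (2π)^D Re(lc (σ i)^D) < 0`.) (new)
[cite: MantovaMasser2023, §1 Further remarks] -/
theorem unprojectedDense_movingGraph {p : Polynomial ℂ} (hp : 0 < p.natDegree) {σ : ℤ}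
    (hσ : σ = 1 ∨ σ = -1) (hlead : (p.leadingCoeff * ((σ : ℂ) * I) ^ p.natDegree).re < 0)
    {A : Polynomial ℂ} (hA : A ≠ 0) (F : MvPolynomial (Fin 2) ℂ) :
    UnprojectedDense (movingGraphSurface p A F) := by
  have hσ0 : (σ : ℂ) ≠ 0 := by rcases hσ with rfl | rfl <;> simp
  have hv0 : (2 * Real.pi * I * (σ : ℂ)) ≠ 0 := by
    have hpi : (Real.pi : ℂ) ≠ 0 := Complex.ofReal_ne_zero.2 Real.pi_ne_zero
    exact mul_ne_zero (mul_ne_zero (mul_ne_zero two_ne_zero hpi) Complex.I_ne_zero) hσ0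
  set q : Fin 1 → ℤ := fun _ => σ with hq
  have hdeg : (p.toMvPolynomial (0 : Fin 1)).totalDegree = p.natDegree :=
    totalDegree_toMvPolynomial_fin_one p
  have hneg : (eval (fun j => 2 * Real.pi * I * (q j : ℂ))
      (homogeneousComponent (p.toMvPolynomial (0 : Fin 1)).totalDegree (p.toMvPolynomial 0))).re < 0 := by
    rw [eval_leadingForm_toMvPolynomial_fin_one]
    simp only [hq]
    have e : p.leadingCoeff * (2 * Real.pi * I * (σ : ℂ)) ^ p.natDegree =
        (((2 * Real.pi) ^ p.natDegree : ℝ) : ℂ) * (p.leadingCoeff * ((σ : ℂ) * I) ^ p.natDegree) := by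
      push_cast; ring
    rw [e, Complex.re_ofReal_mul]
    exact mul_neg_of_pos_of_neg (by positivity) hlead
  have hA' : ∀ j : Fin 1, eval (fun i => 2 * Real.pi * I * (q i : ℂ))
      (homogeneousComponent ((![A.toMvPolynomial (0 : Fin 1)] : Fin 1 → MvPolynomial (Fin 1) ℂ) j).totalDegree
        ((![A.toMvPolynomial (0 : Fin 1)] : Fin 1 → MvPolynomial (Fin 1) ℂ) j)) ≠ 0 := by
    intro j
    rw [Fin.fin_one_eq_zero j, Matrix.cons_val_fin_one]
    exact eval_leadingForm_toMvPolynomial_fin_one_ne_zero hA hv0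
  exact unprojectedDense_polyFibredGraph_one (p.toMvPolynomial 0) (by rw [hdeg]; exact hp) q hneg _
    hA' ![F]

/-- **Lines of NON-REAL slope with `x₀`-dependent fibre polynomial**: for `Im a ≠ 0`, `A ≠ 0` and any
`F ∈ ℂ[u, x₀]` the exponential points of `{x₁ = a x₀ + b, y₀ = A(x₀) + y₁ F(y₁, x₀)}` are Zariski
dense (`σ = sign Im a`). (new) [cite: MantovaMasser2023, §1 Further remarks] -/
theorem unprojectedDense_movingLineX_of_im_ne_zero {a : ℂ} (ha : a.im ≠ 0) (b : ℂ) {A : Polynomial ℂ}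
    (hA : A ≠ 0) (F : MvPolynomial (Fin 2) ℂ) :
    UnprojectedDense (movingGraphSurface (linePoly a b) A F) := by
  have ha0 : a ≠ 0 := fun h => ha (by rw [h, Complex.zero_im])
  obtain ⟨σ, hσ, hpos⟩ : ∃ σ : ℤ, (σ = 1 ∨ σ = -1) ∧ 0 < (σ : ℝ) * a.im := by
    rcases lt_or_gt_of_ne ha with h | h
    · exact ⟨-1, Or.inr rfl, by push_cast; nlinarith⟩
    · exact ⟨1, Or.inl rfl, by push_cast; linarith⟩
  refine unprojectedDense_movingGraph (by rw [linePoly, Polynomial.natDegree_linear ha0]; exact one_pos)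
    hσ ?_ hA F
  rw [linePoly, Polynomial.leadingCoeff_linear ha0, Polynomial.natDegree_linear ha0, pow_one]
  have : (a * ((σ : ℂ) * I)).re = -((σ : ℝ) * a.im) := by
    simp [Complex.mul_re, Complex.mul_im]; ring
  rw [this]
  linarith

/-- **Cell membership for graph bases of degree `≥ 2`** (`deg A ≥ 1`, any `F`): the surface is in
Mantova–Masser's case (dim-pi-S-1-free) and its torus part is multiplicatively free. [folklore] -/
theorem mmCase_movingGraph_of_two_le {p : Polynomial ℂ} (hp : 2 ≤ p.natDegree) {A : Polynomial ℂ}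
    (hA : 0 < A.natDegree) (F : MvPolynomial (Fin 2) ℂ) :
    MMCaseDimPiOneFree (movingGraphSurface p A F) ∧
      IsMulFree ℂ 2 (movingGraphSurface p A F ∩ torusLocus ℂ 2) := by
  have hdom := aeval_toMvPolynomial_fin_one_injective hA
  refine ⟨⟨isIrreducibleClosed_polyFibredGraph _ _ _,
    polyFibredGraph_inter_torusLocus_nonempty _ _ _ hdom, zariskiDim_polyFibredGraph _ _ _,
    addProjDim_polyFibredGraph _ _ _ hdom, ?_⟩, isMulFree_polyFibredGraph _ _ _ hdom⟩
  -- the closure of the base is the graph `x₁ = p(x₀)`, no line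
  have hZ : zeroLocus ℂ (vanishingIdeal ℂ (projAdd '' (movingGraphSurface p A F ∩ torusLocus ℂ 2))) =
      {x : Fin 2 → ℂ | x 1 = p.eval (x 0)} := by
    rw [movingGraphSurface, vanishingIdeal_projAdd_polyFibredGraph _ _ _ hdom, ← vanishingIdeal_graphBase,
      zeroLocus_vanishingIdeal_of_isZariskiClosed (isZariskiClosed_graphBase _)]
    ext x
    simp only [graphBase, Set.mem_setOf_eq, MvPolynomial.eval_toMvPolynomial]
    rfl
  rw [hZ]
  rintro ⟨m, hm, c, hL⟩
  have hsub : ∀ x : ℂ, (m 0 : ℂ) * x + (m 1 : ℂ) * p.eval x = c := by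
    intro x
    have hx : (![x, p.eval x] : Fin 2 → ℂ) ∈ {x : Fin 2 → ℂ | x 1 = p.eval (x 0)} := by simp
    rw [hL] at hx
    simpa using hx
  obtain ⟨h0, h1⟩ := coeffs_eq_zero_of_two_le_natDegree hp (m 0) (m 1) c hsub
  exact hm (funext fun i => by fin_cases i <;> assumption)

/-- **Positive instances of the FREE typed question over graph bases of degree `≥ 2`** under the
leading-coefficient criterion (`deg A ≥ 1`, any `F ∈ ℂ[u, x₀]`): case ∧ free ∧ dense. (new)
[cite: MantovaMasser2023, §1 Further remarks] -/
theorem unprojectedDensityQuestion_instance_movingGraph {p : Polynomial ℂ} (hp : 2 ≤ p.natDegree)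
    {σ : ℤ} (hσ : σ = 1 ∨ σ = -1) (hlead : (p.leadingCoeff * ((σ : ℂ) * I) ^ p.natDegree).re < 0)
    {A : Polynomial ℂ} (hA : 0 < A.natDegree) (F : MvPolynomial (Fin 2) ℂ) :
    MMCaseDimPiOneFree (movingGraphSurface p A F) ∧
      IsMulFree ℂ 2 (movingGraphSurface p A F ∩ torusLocus ℂ 2) ∧
      UnprojectedDense (movingGraphSurface p A F) := by
  have hA0 : A ≠ 0 := by rintro rfl; simp at hA
  obtain ⟨h1, h2⟩ := mmCase_movingGraph_of_two_le hp hA F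
  exact ⟨h1, h2, unprojectedDense_movingGraph (by omega) hσ hlead hA0 F⟩

/-- **Example**: `e^{z} = z + e^{2z²} + z e^{z²}` — the exponential points of
`{x₁ = x₀², y₀ = x₀ + y₁ (y₁ + x₀)}` (base the parabola, `Re(1 · i²) = -1 < 0`; fibre polynomial
`F(u, x₀) = u + x₀` depends on `x₀`) are Zariski dense, and the surface is in the case and free. (new) -/
theorem unprojectedDensityQuestion_instance_parabola_movingX :
    MMCaseDimPiOneFree (movingGraphSurface (Polynomial.X ^ 2) Polynomial.X (X 0 + X 1)) ∧
      IsMulFree ℂ 2 (movingGraphSurface (Polynomial.X ^ 2) Polynomial.X (X 0 + X 1) ∩ torusLocus ℂ 2) ∧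
      UnprojectedDense (movingGraphSurface (Polynomial.X ^ 2) Polynomial.X (X 0 + X 1)) := by
  refine unprojectedDensityQuestion_instance_movingGraph (by rw [Polynomial.natDegree_X_pow]) (σ := 1)
    (Or.inl rfl) ?_ (by rw [Polynomial.natDegree_X]; exact one_pos) _
  rw [Polynomial.leadingCoeff_X_pow, Polynomial.natDegree_X_pow]
  simp [pow_two]

end Univariate

end Summit.Schanuel.Schanuel.Theorems

end
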